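import Literature.InformationTheory.QuantumCodes.CSS
import Literature.InformationTheory.Coding.DelsarteLPBound
import HarnessLib

/-!
# Split MacWilliams identity for a systematic binary code `{(v, vP)}` (three coordinate parts)

LADDER-QEC (venture cell `qec`), certificate infrastructure of the type-10 lane (certificate CHECKER + soundness), written for the
last open cell `(16, 1)` of the optimal-CSS-distance table `n ≤ 16` (census/type-02/css161: «no CSS `[[16,1,5]]`», COMPUTED) and
usable for every `k = 1` CSS cell. This file is the IDENTITY; `Census/CSSK1SplitLP.lean` is the linear system + Farkas soundness.

MATHEMATICS (known; MacWilliams–Sloane Ch. 5): for `P ∈ 𝔽₂^{κ × μ}` and `S ⊆ μ`, the systematic code `B = {(v, vP) : v ∈ 𝔽₂^κ}`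
has dual `B^⊥ = {(Pu, u) : u ∈ 𝔽₂^μ}`; for the coordinate partition (information block `κ` | `S` | `Sᶜ`) the SPLIT weight
enumerators of `B` and `B^⊥` are related by the MacWilliams transform part by part. In Krawtchouk form (what a linear program
consumes), for every dual split type `(i, j, l)`:

  `Σ_{v ∈ 𝔽₂^κ} K_i(wt v; |κ|) · K_j(wt_S(vP); |S|) · K_l(wt_{Sᶜ}(vP); |Sᶜ|) = 2^{|κ|} · #{u ∈ 𝔽₂^μ : wt(Pu) = i, wt_S(u) = j, wt_{Sᶜ}(u) = l}`

(`sum_kprod_eq`). PROOF (self-contained, ≈ MacWilliams–Sloane Ch. 5 §2 Lemma 2 / Thm. 1 with §3 Problem (14)): Delsarte's lemma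
on each part — `Σ_{T ⊆ R, |T| = k} χ_T(z) = K_k(wt_R(z); |R|)` (`sum_chi_powersetCard`, the coordinate-subset form of the tree's
`Coding.sum_signChar_eq_krawtchouk`) — turns the left side into a sum over triples `(T₁, T₂, T₃)` of character sums
`Σ_v (−1)^{v · (1_{T₁} + P(1_{T₂} + 1_{T₃}))}`, which by orthogonality (`sum_zsign_dotProduct`) count the triples with
`1_{T₁} = P (1_{T₂} + 1_{T₃})`, i.e. the `u = 1_{T₂} + 1_{T₃}` of dual split type `(i, j, l)`.
Vocabulary: vectors `κ → ZMod 2` and `Matrix κ μ (ZMod 2)` with Mathlib's `vecMul`/`mulVec`/`dotProduct` (the vocabulary of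
`QuantumCodes/CSS.lean` and of qec-type-02's `Census/CSSNormalFormK1.lean`); `krawtchouk` of `Coding/DelsarteLPBound.lean`.
No new mathematics is claimed; 0 `decide`, axioms standard. [cite: MacWilliamsSloane1977, Ch. 5 §2 Thm. 1 and Lemma 2, §3 Problem (14), §6 eq. (52) (split weight enumerators)]
-/

namespace Summit.Ventures.QEC.Census.CSSK1LP

open Finset Matrix Polynomial Literature.InformationTheory.Coding

/-! ## 1. Characters of `𝔽₂`-vectors -/

section Characters

variable {ι : Type*} [DecidableEq ι]

/-- The sign `(−1)^a` of a bit `a ∈ 𝔽₂`. [folklore] -/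
def zsign (a : ZMod 2) : ℤ := if a = 0 then 1 else -1

/-- `(−1)^{a+b} = (−1)^a (−1)^b`. [folklore] -/
theorem zsign_add (a b : ZMod 2) : zsign (a + b) = zsign a * zsign b := by
  fin_cases a <;> fin_cases b <;> rfl

/-- `zsign 0 = 1`. [folklore] -/
@[simp] theorem zsign_zero : zsign 0 = 1 := rfl

/-- `zsign 1 = −1`. [folklore] -/
@[simp] theorem zsign_one : zsign 1 = -1 := rfl

/-- The Hamming weight of `z` on the coordinate set `R`: `#{q ∈ R : z_q ≠ 0}`. [folklore] -/
def wtOn (R : Finset ι) (z : ι → ZMod 2) : ℕ := #(R.filter fun q => z q ≠ 0)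

/-- The character `χ_T(z) = ∏_{q ∈ T} (−1)^{z_q}`. [cite: MacWilliamsSloane1977, Ch. 5 §3 eq. (27)] -/
def chi (T : Finset ι) (z : ι → ZMod 2) : ℤ := ∏ q ∈ T, zsign (z q)

omit [DecidableEq ι] in
/-- `χ_T(z) = (−1)^{Σ_{q ∈ T} z_q}`. [folklore] -/
theorem chi_eq_zsign_sum (T : Finset ι) (z : ι → ZMod 2) : chi T z = zsign (∑ q ∈ T, z q) := by
  induction T using Finset.cons_induction with
  | empty => simp [chi]
  | cons a T ha ih =>
    unfold chi at ih ⊢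
    rw [prod_cons, sum_cons, zsign_add, ih]

omit [DecidableEq ι] in
/-- **Delsarte's lemma on a coordinate subset** `R`: `Σ_{T ⊆ R, |T| = k} χ_T(z) = K_k(wt_R(z); |R|)`.
(The tree's `sum_signChar_eq_krawtchouk` is the case `R = univ` for Bool words on `Fin n`; same generating-function proof.)
[cite: MacWilliamsSloane1977, Ch. 5 §3 Problem (14)] -/
theorem sum_chi_powersetCard (R : Finset ι) (k : ℕ) (z : ι → ZMod 2) :
    ∑ T ∈ R.powersetCard k, chi T z = krawtchouk #R k (wtOn R z) := by
  classical
  set P : ℤ[X] := ∏ q ∈ R, (1 + C (zsign (z q)) * X) with hP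
  have hPa : P = ∑ T ∈ R.powerset, C (chi T z) * X ^ #T := by
    rw [hP, Finset.prod_one_add]
    refine Finset.sum_congr rfl fun T _ => ?_
    rw [Finset.prod_mul_distrib, Finset.prod_const, chi, map_prod]
  have hcoeffa : P.coeff k = ∑ T ∈ R.powersetCard k, chi T z := by
    rw [hPa, finsetSum_coeff, Finset.powersetCard_eq_filter, Finset.sum_filter]
    refine Finset.sum_congr rfl fun T _ => ?_
    rw [coeff_C_mul_X_pow]
    split_ifs with h1 h2 h2 <;> simp_all
  have hPb : P = ((1 : ℤ[X]) - X) ^ (wtOn R z) * (1 + X) ^ (#R - wtOn R z) := by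
    have hstep : P = ∏ q ∈ R, (if z q ≠ 0 then ((1 : ℤ[X]) - X) else 1 + X) := by
      rw [hP]
      refine Finset.prod_congr rfl fun q _ => ?_
      by_cases hq : z q = 0
      · simp [zsign, hq]
      · simp only [zsign, hq, if_false, ne_eq, not_false_eq_true, if_true, map_neg, C_1, neg_mul, one_mul]
        ring
    rw [hstep, Finset.prod_ite, Finset.prod_const, Finset.prod_const]
    congr 2
    have := Finset.card_filter_add_card_filter_not (s := R) (fun q => z q ≠ 0)
    unfold wtOn
    omega
  rw [← hcoeffa, hPb, coeff_krawtchoukGen]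

variable [Fintype ι]

/-- **Orthogonality of characters on `𝔽₂^ι`**: `Σ_v (−1)^{v·x} = 2^{|ι|}` if `x = 0`, else `0`
(the involution `v ↦ v + e_{q₀}` at a coordinate with `x_{q₀} = 1` negates the sum). [cite: MacWilliamsSloane1977, Ch. 5 §2 Lemma 2 (proof)] -/
theorem sum_zsign_dotProduct (x : ι → ZMod 2) :
    ∑ v : ι → ZMod 2, zsign (v ⬝ᵥ x) = if x = 0 then (2 : ℤ) ^ Fintype.card ι else 0 := by
  split_ifs with hx
  · simp [hx, ZMod.card]
  · obtain ⟨q₀, hq₀⟩ : ∃ q, x q ≠ 0 := by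
      by_contra h
      push Not at h
      exact hx (funext h)
    have hx1 : x q₀ = 1 := by
      have := (show ∀ a : ZMod 2, a = 0 ∨ a = 1 by decide) (x q₀)
      tauto
    have key : ∀ v : ι → ZMod 2, zsign ((v + Pi.single q₀ 1) ⬝ᵥ x) = -zsign (v ⬝ᵥ x) := by
      intro v
      rw [add_dotProduct, zsign_add, single_dotProduct, one_mul, hx1, zsign_one]
      ring
    have hbij : ∑ v : ι → ZMod 2, zsign ((v + Pi.single q₀ 1) ⬝ᵥ x) = ∑ v : ι → ZMod 2, zsign (v ⬝ᵥ x) :=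
      Fintype.sum_equiv (Equiv.addRight (Pi.single q₀ 1)) _ _ (fun v => rfl)
    simp_rw [key] at hbij
    rw [sum_neg_distrib] at hbij
    linarith

/-- The indicator vector `1_T ∈ 𝔽₂^ι` of a finite set of coordinates. [folklore] -/
def indVec (T : Finset ι) : ι → ZMod 2 := fun q => if q ∈ T then 1 else 0

omit [Fintype ι] in
/-- `1_T q ≠ 0 ↔ q ∈ T`. [folklore] -/
theorem indVec_ne_zero_iff (T : Finset ι) (q : ι) : indVec T q ≠ 0 ↔ q ∈ T := by
  unfold indVec; split_ifs with h <;> simp [h]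

/-- `χ_T(z) = (−1)^{z · 1_T}`. [folklore] -/
theorem chi_eq_zsign_dotProduct (T : Finset ι) (z : ι → ZMod 2) : chi T z = zsign (z ⬝ᵥ indVec T) := by
  rw [chi_eq_zsign_sum]
  congr 1
  simp only [dotProduct, indVec, mul_ite, mul_one, mul_zero]
  rw [Finset.sum_ite_mem, univ_inter]

end Characters

/-! ## 2. The split MacWilliams identity for a systematic code `{(v, vP)}` (three parts: information block, `S`, `Sᶜ`) -/

section Split

variable {κ μ : Type*} [Fintype κ] [Fintype μ] [DecidableEq κ] [DecidableEq μ]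

/-- The product of the three Krawtchouk sums for one information word `v`. (local abbreviation) [folklore] -/
def kprod (P : Matrix κ μ (ZMod 2)) (S : Finset μ) (i j l : ℕ) (v : κ → ZMod 2) : ℤ :=
  krawtchouk (Fintype.card κ) i (wtOn univ v) *
    (krawtchouk #S j (wtOn S (v ᵥ* P)) * krawtchouk #Sᶜ l (wtOn Sᶜ (v ᵥ* P)))

/-- For `T₂ ⊆ S`, `T₃ ⊆ Sᶜ`: the word `1_{T₂} + 1_{T₃}` is nonzero exactly on `T₂ ∪ T₃`. [folklore] -/
theorem indVec_add_ne_zero_iff {S T₂ T₃ : Finset μ} (h₂ : T₂ ⊆ S) (h₃ : T₃ ⊆ Sᶜ) (q : μ) :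
    (indVec T₂ + indVec T₃) q ≠ 0 ↔ q ∈ T₂ ∨ q ∈ T₃ := by
  have hdis : ¬ (q ∈ T₂ ∧ q ∈ T₃) := fun ⟨a, b⟩ => by
    have := h₃ b
    rw [Finset.mem_compl] at this
    exact this (h₂ a)
  simp only [Pi.add_apply, indVec]
  split_ifs with a b b <;> simp_all

/-- **Split MacWilliams identity (`Σ_v` form).** For `P : 𝔽₂^{κ × μ}` and `S ⊆ μ`:
`Σ_{v ∈ 𝔽₂^κ} K_i(wt v) K_j(wt_S(vP)) K_l(wt_{Sᶜ}(vP)) = 2^{|κ|} · #{u ∈ 𝔽₂^μ : wt(Pu) = i, wt_S(u) = j, wt_{Sᶜ}(u) = l}`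
— the MacWilliams identity between the systematic code `{(v, vP)}` and its dual `{(Pu, u)}` for the SPLIT weight enumerator
w.r.t. the coordinate partition (information block | `S` | `Sᶜ`), in Krawtchouk form (Delsarte's lemma on each part +
orthogonality of characters). [cite: MacWilliamsSloane1977, Ch. 5 §6 (split weight enumerators / eq. (52)) and Ch. 5 §2 Thm. 1] -/
theorem sum_kprod_eq (P : Matrix κ μ (ZMod 2)) (S : Finset μ) (i j l : ℕ) :
    ∑ v : κ → ZMod 2, kprod P S i j l v =
      (2 : ℤ) ^ Fintype.card κ *
        #((univ : Finset (μ → ZMod 2)).filter fun u => wtOn univ (P *ᵥ u) = i ∧ wtOn S u = j ∧ wtOn Sᶜ u = l) := by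
  classical
  -- (a) Delsarte on each part; product of sums = sum over triples
  set A := (univ : Finset κ).powersetCard i with hA
  set B := S.powersetCard j with hB
  set Cc := Sᶜ.powersetCard l with hCc
  have hexp : ∀ v : κ → ZMod 2, kprod P S i j l v =
      ∑ p ∈ A ×ˢ (B ×ˢ Cc), zsign (v ⬝ᵥ (indVec p.1 + P *ᵥ (indVec p.2.1 + indVec p.2.2))) := by
    intro v
    have h1 : krawtchouk (Fintype.card κ) i (wtOn univ v) = ∑ T ∈ A, chi T v := by
      rw [hA, sum_chi_powersetCard, card_univ]
    have h2 : krawtchouk #S j (wtOn S (v ᵥ* P)) = ∑ T ∈ B, chi T (v ᵥ* P) := by rw [hB, sum_chi_powersetCard]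
    have h3 : krawtchouk #Sᶜ l (wtOn Sᶜ (v ᵥ* P)) = ∑ T ∈ Cc, chi T (v ᵥ* P) := by rw [hCc, sum_chi_powersetCard]
    rw [kprod, h1, h2, h3, Finset.sum_product]
    simp_rw [Finset.sum_product]
    rw [Finset.sum_mul]
    refine Finset.sum_congr rfl fun T₁ _ => ?_
    rw [Finset.sum_mul_sum, Finset.mul_sum]
    refine Finset.sum_congr rfl fun T₂ _ => ?_
    rw [Finset.mul_sum]
    refine Finset.sum_congr rfl fun T₃ _ => ?_
    rw [chi_eq_zsign_dotProduct, chi_eq_zsign_dotProduct, chi_eq_zsign_dotProduct, ← zsign_add, ← zsign_add,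
      ← dotProduct_mulVec, ← dotProduct_mulVec, ← dotProduct_add, ← mulVec_add, ← dotProduct_add]
  simp_rw [hexp]
  rw [Finset.sum_comm]
  simp_rw [sum_zsign_dotProduct]
  rw [Finset.sum_ite, Finset.sum_const_zero, add_zero, Finset.sum_const, nsmul_eq_mul, mul_comm]
  congr 1
  -- (b) the triples with `1_{T₁} = P (1_{T₂} + 1_{T₃})` are in bijection with the `u` of split type `(i, j, l)`
  have hF2 : ∀ a : ZMod 2, a ≠ 0 → a = 1 := by decide
  have hadd : ∀ a b : ZMod 2, a + b = 0 → b = a := by decide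
  refine congrArg Nat.cast (Finset.card_bij' (fun p _ => indVec p.2.1 + indVec p.2.2)
    (fun u _ => ((univ : Finset κ).filter fun q => (P *ᵥ u) q ≠ 0,
      (S.filter fun q => u q ≠ 0, Sᶜ.filter fun q => u q ≠ 0))) ?_ ?_ ?_ ?_)
  · -- forward map lands in the `u`-set
    rintro ⟨T₁, T₂, T₃⟩ hp
    simp only [Finset.mem_filter, Finset.mem_product, hA, hB, hCc, Finset.mem_powersetCard, Finset.mem_univ,
      true_and] at hp ⊢
    obtain ⟨⟨⟨-, h1⟩, ⟨h2s, h2⟩, ⟨h3s, h3⟩⟩, heq⟩ := hp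
    have hu : ∀ q, (indVec T₂ + indVec T₃) q ≠ 0 ↔ q ∈ T₂ ∨ q ∈ T₃ := indVec_add_ne_zero_iff h2s h3s
    have hPu : P *ᵥ (indVec T₂ + indVec T₃) = indVec T₁ := by
      funext q
      exact hadd _ _ (congrFun heq q)
    refine ⟨?_, ?_, ?_⟩
    · unfold wtOn
      rw [← h1]
      congr 1
      ext q
      simp [hPu, indVec_ne_zero_iff]
    · unfold wtOn
      rw [← h2]
      congr 1
      ext q
      simp only [Finset.mem_filter, hu]
      constructor
      · rintro ⟨hq, h | h⟩
        · exact h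
        · exact absurd hq (Finset.mem_compl.mp (h3s h))
      · exact fun h => ⟨h2s h, Or.inl h⟩
    · unfold wtOn
      rw [← h3]
      congr 1
      ext q
      simp only [Finset.mem_filter, hu]
      constructor
      · rintro ⟨hq, h | h⟩
        · exact absurd (h2s h) (Finset.mem_compl.mp hq)
        · exact h
      · exact fun h => ⟨h3s h, Or.inr h⟩
  · -- backward map lands in the triple set
    intro u hu
    simp only [Finset.mem_filter, Finset.mem_univ, true_and] at hu
    obtain ⟨h1, h2, h3⟩ := hu
    simp only [Finset.mem_filter, Finset.mem_product, hA, hB, hCc, Finset.mem_powersetCard, Finset.subset_univ,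
      Finset.filter_subset, true_and]
    refine ⟨⟨h1, h2, h3⟩, ?_⟩
    -- 1_{supp Pu} + P (1_{supp u ∩ S} + 1_{supp u ∩ Sᶜ}) = 0
    have hsum : indVec (S.filter fun q => u q ≠ 0) + indVec (Sᶜ.filter fun q => u q ≠ 0) = u := by
      funext q
      simp only [Pi.add_apply, indVec, Finset.mem_filter, Finset.mem_compl]
      by_cases hq : u q = 0
      · simp [hq]
      · have := hF2 _ hq
        by_cases hs : q ∈ S <;> simp [hs, this]
    rw [hsum]
    funext q
    simp only [Pi.add_apply, Pi.zero_apply, indVec, Finset.mem_filter, Finset.mem_univ, true_and]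
    by_cases hq : (P *ᵥ u) q = 0
    · simp [hq]
    · simp [hF2 _ hq]
      decide
  · -- left inverse
    rintro ⟨T₁, T₂, T₃⟩ hp
    simp only [Finset.mem_filter, Finset.mem_product, hA, hB, hCc, Finset.mem_powersetCard] at hp
    obtain ⟨⟨⟨-, h1⟩, ⟨h2s, h2⟩, ⟨h3s, h3⟩⟩, heq⟩ := hp
    have hu : ∀ q, (indVec T₂ + indVec T₃) q ≠ 0 ↔ q ∈ T₂ ∨ q ∈ T₃ := indVec_add_ne_zero_iff h2s h3s
    have hPu : P *ᵥ (indVec T₂ + indVec T₃) = indVec T₁ := by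
      funext q
      exact hadd _ _ (congrFun heq q)
    ext : 1
    · ext q; simp [hPu, indVec_ne_zero_iff]
    · ext : 1
      · ext q
        simp only [Finset.mem_filter, hu]
        constructor
        · rintro ⟨hq, h | h⟩
          · exact h
          · exact absurd hq (Finset.mem_compl.mp (h3s h))
        · exact fun h => ⟨h2s h, Or.inl h⟩
      · ext q
        simp only [Finset.mem_filter, hu]
        constructor
        · rintro ⟨hq, h | h⟩
          · exact absurd (h2s h) (Finset.mem_compl.mp hq)
          · exact h
        · exact fun h => ⟨h3s h, Or.inr h⟩
  · -- right inverse
    intro u hu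
    funext q
    simp only [Pi.add_apply, indVec, Finset.mem_filter, Finset.mem_compl]
    by_cases hq : u q = 0
    · simp [hq]
    · have := hF2 _ hq
      by_cases hs : q ∈ S <;> simp [hs, this]

end Split

end Summit.Ventures.QEC.Census.CSSK1LP
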